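import Literature.AlgebraicGeometry.AbelianSchemes.FrobeniusVersusHeckeSerreTensor
import HarnessLib

/-!
# Ideal translations compose: `(A ⊗ 𝔭⁻¹) ⊗ 𝔠⁻¹ ≅ A ⊗ (𝔭𝔠)⁻¹` under `A`, with `ψ_𝔭 ≫ ψ_𝔠 ↦ ψ_{𝔭𝔠}`

Topic `Literature/AlgebraicGeometry/AbelianSchemes`, namespace `Literature.AlgebraicGeometry.AbelianSchemes.AbelianSchemeOver` (THEOREMS ONLY; no
definition, no named fact, no `sorry`, no `instance`, no notation; ANY base scheme `S`).  Cell `hodgecm-mathlib`, F0/P6 «MOD», sequel to ★ (σ2-CORE)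
`FrobeniusVersusHeckeSerreTensor` §1∕§3 (the principal case `𝔭𝔠 = (π₀)`, target `A` itself): the `π₀`-FREE composition of two ideal translations, as needed
by the desk՚s D-3 route «(FR) + (TW) at `γ_σ`» (compare the Frobenius twist with the Hecke tuple Serre-twisted by `𝔞 = twistIdeal γ_σ = 𝔭_w^{d_w}·𝔟` AS AN
IDEAL, levels transported along `ψ_𝔞` — NOTE «π₀ and exact level», cell bus 2026-09-01 18:37Z); `--supports stmt-HodgeConjecture-24832`, count-neutral.
HC_CM is proved only modulo the 2 remaining named inputs (hLiu418, h413) until rung 0 closes; this file discharges none of them.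

## Mathematics

Let `(A, ι)` be an `𝒪`-abelian scheme over `S` with commutative group law, and let `ψ_𝔭 : A → A ⊗ 𝔭⁻¹`, `ψ_𝔠 : A ⊗ 𝔭⁻¹ → (A ⊗ 𝔭⁻¹) ⊗ 𝔠⁻¹` and
`ψ_𝔞 : A → A ⊗ 𝔞⁻¹` be the ideal translations of ★ (A) `SerreTensorIdealTranslationKernel` for presented modules with columns `P₁, P₂, P₃` whose coordinates
generate `𝔭`, `𝔠`, `𝔞`, each with a quasi-inverse row up to a non-zero integer (so each translation is an `𝒪`-equivariant finite flat surjective homomorphism).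
If **`𝔭·𝔠 = 𝔞`** then `Ker(ψ_𝔭 ≫ ψ_𝔠) = A[𝔭𝔠] = A[𝔞] = Ker ψ_𝔞` on `T`-points (★ σ2-CORE §1 `comp_serreTranslate_comp_serreTranslate_eq_one_iff_forall_mem`, ★ (A)
`comp_serreTranslate_eq_one_iff_forall_mem`), so ★ KER-EQ gives a UNIQUE isomorphism **`e : (A ⊗ 𝔭⁻¹) ⊗ 𝔠⁻¹ ≅ A ⊗ 𝔞⁻¹` under `A` with `ψ_𝔭 ≫ ψ_𝔠 ≫ e = ψ_𝔞`**;
it is a homomorphism and `𝒪`-equivariant — Serre՚s tensor construction is multiplicative in the ideal, `(M ⊗_𝒪 A) ⊗_𝒪 N = (M ⊗ N) ⊗_𝒪 A` for invertible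
ideals, here pinned UNDER `A` by the translations (B. Conrad, *Gross–Zagier revisited* §7; J. Milne, *Complex Multiplication* §7: `(A^𝔞)^𝔟 = A^{𝔞𝔟}`).
Consequently (§2) `ψ_𝔠 ≫ e = ` the unique factorisation of `ψ_𝔞` through `ψ_𝔭`, and in the σ2-CORE setting `F ≫ (e₁ ≫ e) = ρ′ ≫ ψ_𝔠 ≫ e` exhibits
`A^{(q)} ≅ B ⊗ 𝔞⁻¹` with NO global generator of `𝔞` chosen.

## Contents

* §1 **`exists_iso_serreTranslate_comp_serreTranslate_comp_eq_serreTranslate`** (`(A ⊗ 𝔭⁻¹) ⊗ 𝔠⁻¹ ≅ A ⊗ (𝔭𝔠)⁻¹`, `ψ_𝔭 ≫ ψ_𝔠 ≫ e = ψ_{𝔭𝔠}`, hom, equivariant,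
  unique).
* §2 **`exists_iso_relFrobeniusHom_comp_eq_comp_serreTranslate_of_mul_eq`** (σ2-CORE, `π₀`-free form: `A^{(q)} ≅ B ⊗ 𝔞⁻¹` with
  `F ≫ e′ ≫ [unique factor] …` packaged as `∃ e′ : A^{(q)} ≅ B ⊗ 𝔞⁻¹, IsMonHom ∧ equivariant ∧ ∃ χ, ψ_𝔭 ≫ χ = ψ_𝔞 ∧ F ≫ e′ = ρ′ ≫ χ`).

## References
* [Conrad2004GrossZagier] B. Conrad, *Gross–Zagier revisited* (2004), §7 Thm. 7.5 (Serre tensor; functoriality and multiplicativity in the module).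
* [MilneCM2006] J. S. Milne, *Complex Multiplication* (2006), §7 (Def. 7.19, Prop. 7.22, Rem. 7.23: `𝔞`-multiplications compose, `(A^𝔞)^𝔟 ≅ A^{𝔞𝔟}`).
* [MumfordAV1970] D. Mumford, *Abelian Varieties* (1970), §7 Thm. 4 (p. 72).
* [Shimura1998] G. Shimura, *Abelian Varieties with Complex Multiplication and Modular Functions* (1998), §7.5–§7.6 (`𝔞`-transforms), §13.1 Thm. 1.
* [RapoportSmithlingZhang2020Diagonal] M. Rapoport, B. Smithling, W. Zhang (2020), §4.3 (p. 20).
* Tree: ★ `FrobeniusVersusHeckeSerreTensor` (σ2-CORE §1–§2), ★ `AbelianSchemeHomDescentKernelEq` (KER-EQ), ★ `SerreTensorIdealTranslationKernel` (A),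
  ★ `SerreTensorRecognition` (`quasiCompact_serreTranslate_left`).
-/

noncomputable section

universe u

open CategoryTheory CategoryTheory.Limits AlgebraicGeometry MonoidalCategory CartesianMonoidalCategory
open scoped MonObj

namespace Literature.AlgebraicGeometry.AbelianSchemes

namespace AbelianSchemeOver

/-! ## §1 `(A ⊗ 𝔭⁻¹) ⊗ 𝔠⁻¹ ≅ A ⊗ (𝔭𝔠)⁻¹` under `A` -/

section Compose

variable {S : Scheme.{u}} {A : AbelianSchemeOver S} {O : Type*} [CommRing O] (act : A.RingAction O) [IsCommMonObj A.X]
  {m₁ : ℕ} (E₁ : Matrix (Fin m₁) (Fin m₁) O) (hE₁ : E₁ * E₁ = E₁) (P₁ : Matrix (Fin m₁) (Fin 1) O) (Q₁ : Matrix (Fin 1) (Fin m₁) O) {N₁ : ℕ}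
  {m₂ : ℕ} (E₂ : Matrix (Fin m₂) (Fin m₂) O) (hE₂ : E₂ * E₂ = E₂) (P₂ : Matrix (Fin m₂) (Fin 1) O) (Q₂ : Matrix (Fin 1) (Fin m₂) O) {N₂ : ℕ}
  {m₃ : ℕ} (E₃ : Matrix (Fin m₃) (Fin m₃) O) (hE₃ : E₃ * E₃ = E₃) (P₃ : Matrix (Fin m₃) (Fin 1) O) (Q₃ : Matrix (Fin 1) (Fin m₃) O) {N₃ : ℕ}
  [IsCommMonObj (serreTensor act E₁ hE₁).X]

/-- **IDEAL TRANSLATIONS COMPOSE**: if the coordinates of `P₁`, `P₂`, `P₃` generate `𝔭`, `𝔠`, `𝔞` with `𝔭·𝔠 = 𝔞` (each column with a quasi-inverse row up to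
a non-zero integer), there is a UNIQUE isomorphism `e : (A ⊗ 𝔭⁻¹) ⊗ 𝔠⁻¹ ≅ A ⊗ 𝔞⁻¹` of `S`-schemes with `ψ_𝔭 ≫ ψ_𝔠 ≫ e = ψ_𝔞`; it is a homomorphism and
`𝒪`-equivariant (★ KER-EQ: both sides are `𝒪`-equivariant fppf homomorphisms out of `A` with kernel `A[𝔭𝔠] = A[𝔞]` on points, ★ σ2-CORE §1).
[cite: MilneCM2006, §7 (Def. 7.19, Prop. 7.22, Rem. 7.23)] [cite: Conrad2004GrossZagier, §7 (Thm. 7.5)] [cite: MumfordAV1970, §7 Thm. 4 (p. 72)] -/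
theorem exists_iso_serreTranslate_comp_serreTranslate_comp_eq_serreTranslate
    (hN₁ : N₁ ≠ 0) (hP₁ : E₁ * P₁ = P₁) (hQ₁ : Q₁ * E₁ = Q₁)
    (hQP₁ : Q₁ * P₁ = Matrix.scalar (Fin 1) (N₁ : O)) (hPQ₁ : P₁ * Q₁ = Matrix.scalar (Fin m₁) (N₁ : O) * E₁)
    (hN₂ : N₂ ≠ 0) (hP₂ : E₂ * P₂ = P₂) (hQ₂ : Q₂ * E₂ = Q₂)
    (hQP₂ : Q₂ * P₂ = Matrix.scalar (Fin 1) (N₂ : O)) (hPQ₂ : P₂ * Q₂ = Matrix.scalar (Fin m₂) (N₂ : O) * E₂)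
    (hN₃ : N₃ ≠ 0) (hP₃ : E₃ * P₃ = P₃) (hQ₃ : Q₃ * E₃ = Q₃)
    (hQP₃ : Q₃ * P₃ = Matrix.scalar (Fin 1) (N₃ : O)) (hPQ₃ : P₃ * Q₃ = Matrix.scalar (Fin m₃) (N₃ : O) * E₃)
    {𝔭 𝔠 𝔞 : Ideal O} (h𝔭 : Ideal.span (Set.range fun k => P₁ k 0) = 𝔭) (h𝔠 : Ideal.span (Set.range fun k => P₂ k 0) = 𝔠)
    (h𝔞 : Ideal.span (Set.range fun k => P₃ k 0) = 𝔞) (hmul : 𝔭 * 𝔠 = 𝔞) :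
    ∃ e : (serreTensor (serreAction act E₁ hE₁) E₂ hE₂).X ≅ (serreTensor act E₃ hE₃).X,
      serreTranslate act E₁ hE₁ P₁ ≫ serreTranslate (serreAction act E₁ hE₁) E₂ hE₂ P₂ ≫ e.hom = serreTranslate act E₃ hE₃ P₃ ∧ IsMonHom e.hom ∧
        (∀ a, (serreAction (serreAction act E₁ hE₁) E₂ hE₂).i a ≫ e.hom = e.hom ≫ (serreAction act E₃ hE₃).i a) ∧
          ∀ χ : (serreTensor (serreAction act E₁ hE₁) E₂ hE₂).X ⟶ (serreTensor act E₃ hE₃).X,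
            serreTranslate act E₁ hE₁ P₁ ≫ serreTranslate (serreAction act E₁ hE₁) E₂ hE₂ P₂ ≫ χ = serreTranslate act E₃ hE₃ P₃ → χ = e.hom := by
  -- fppf and homomorphism properties of the three translations
  haveI := isMonHom_serreTranslate act E₁ hE₁ P₁
  haveI := isFinite_serreTranslate_left act E₁ hE₁ P₁ Q₁ hN₁ hP₁ hQ₁ hQP₁ hPQ₁
  haveI := flat_serreTranslate_left act E₁ hE₁ P₁ Q₁ hN₁ hP₁ hQ₁ hQP₁ hPQ₁
  haveI := surjective_serreTranslate_left act E₁ hE₁ P₁ Q₁ hN₁ hP₁ hQ₁ hQP₁ hPQ₁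
  haveI := isMonHom_serreTranslate (serreAction act E₁ hE₁) E₂ hE₂ P₂
  haveI := isFinite_serreTranslate_left (serreAction act E₁ hE₁) E₂ hE₂ P₂ Q₂ hN₂ hP₂ hQ₂ hQP₂ hPQ₂
  haveI := flat_serreTranslate_left (serreAction act E₁ hE₁) E₂ hE₂ P₂ Q₂ hN₂ hP₂ hQ₂ hQP₂ hPQ₂
  haveI := surjective_serreTranslate_left (serreAction act E₁ hE₁) E₂ hE₂ P₂ Q₂ hN₂ hP₂ hQ₂ hQP₂ hPQ₂
  haveI := isMonHom_serreTranslate act E₃ hE₃ P₃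
  haveI := isFinite_serreTranslate_left act E₃ hE₃ P₃ Q₃ hN₃ hP₃ hQ₃ hQP₃ hPQ₃
  haveI := flat_serreTranslate_left act E₃ hE₃ P₃ Q₃ hN₃ hP₃ hQ₃ hQP₃ hPQ₃
  haveI := surjective_serreTranslate_left act E₃ hE₃ P₃ Q₃ hN₃ hP₃ hQ₃ hQP₃ hPQ₃
  haveI : Flat (serreTranslate act E₁ hE₁ P₁ ≫ serreTranslate (serreAction act E₁ hE₁) E₂ hE₂ P₂).left := by
    rw [Over.comp_left]; infer_instance
  haveI : Surjective (serreTranslate act E₁ hE₁ P₁ ≫ serreTranslate (serreAction act E₁ hE₁) E₂ hE₂ P₂).left := by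
    rw [Over.comp_left]; infer_instance
  haveI : QuasiCompact (serreTranslate act E₁ hE₁ P₁ ≫ serreTranslate (serreAction act E₁ hE₁) E₂ hE₂ P₂).left := by
    rw [Over.comp_left]; infer_instance
  -- equivariance of the composite and equality of kernels `A[𝔭𝔠] = A[𝔞]`
  have hψ : ∀ a, act.i a ≫ serreTranslate act E₁ hE₁ P₁ ≫ serreTranslate (serreAction act E₁ hE₁) E₂ hE₂ P₂ =
      (serreTranslate act E₁ hE₁ P₁ ≫ serreTranslate (serreAction act E₁ hE₁) E₂ hE₂ P₂) ≫
        (serreAction (serreAction act E₁ hE₁) E₂ hE₂).i a := fun a => by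
    simp only [← Category.assoc, i_comp_serreTranslate act E₁ hE₁ P₁ hP₁ a]
    simp only [Category.assoc, i_comp_serreTranslate (serreAction act E₁ hE₁) E₂ hE₂ P₂ hP₂ a]
  have hker : ∀ ⦃T : Over S⦄ (t : T ⟶ A.X),
      t ≫ serreTranslate act E₁ hE₁ P₁ ≫ serreTranslate (serreAction act E₁ hE₁) E₂ hE₂ P₂ = 1 ↔ t ≫ serreTranslate act E₃ hE₃ P₃ = 1 := by
    intro T t
    rw [comp_serreTranslate_comp_serreTranslate_eq_one_iff_forall_mem act E₁ hE₁ P₁ E₂ hE₂ P₂ hP₁ hP₂ h𝔭 h𝔠,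
      comp_serreTranslate_eq_one_iff_forall_mem act E₃ hE₃ P₃ hP₃ h𝔞, hmul]
  obtain ⟨e, he, hmon, heq, huniq⟩ := exists_iso_comp_eq_equivariant_of_comp_eq_one_iff
    (serreTranslate act E₁ hE₁ P₁ ≫ serreTranslate (serreAction act E₁ hE₁) E₂ hE₂ P₂) (serreTranslate act E₃ hE₃ P₃) act
    (serreAction act E₃ hE₃) (serreAction (serreAction act E₁ hE₁) E₂ hE₂) hψ (i_comp_serreTranslate act E₃ hE₃ P₃ hP₃) hker
  exact ⟨e, by rw [← Category.assoc]; exact he, hmon, heq, fun χ hχ => huniq χ (by rw [Category.assoc]; exact hχ)⟩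

omit [IsCommMonObj (serreTensor act E₁ hE₁).X] in
/-- **… read on `A ⊗ 𝔭⁻¹`**: with `e` as in §1, `ψ_𝔠 ≫ e : A ⊗ 𝔭⁻¹ → A ⊗ 𝔞⁻¹` is the UNIQUE morphism `χ` with `ψ_𝔭 ≫ χ = ψ_𝔞` (cancel the fppf
epimorphism `ψ_𝔭`), an `𝒪`-equivariant homomorphism — the «cover `A ⊗ 𝔭⁻¹ → A ⊗ (𝔭𝔠)⁻¹`» of the inclusion `𝔭⁻¹ ⊂ (𝔭𝔠)⁻¹`.
[cite: MilneCM2006, §7 (Def. 7.19, Prop. 7.22, Rem. 7.23)] [cite: MumfordAV1970, §7 Thm. 4 (p. 72)] -/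
theorem comp_eq_of_serreTranslate_comp_eq (hN₁ : N₁ ≠ 0) (hP₁ : E₁ * P₁ = P₁) (hQ₁ : Q₁ * E₁ = Q₁)
    (hQP₁ : Q₁ * P₁ = Matrix.scalar (Fin 1) (N₁ : O)) (hPQ₁ : P₁ * Q₁ = Matrix.scalar (Fin m₁) (N₁ : O) * E₁)
    {X : Over S} (χ₁ χ₂ : (serreTensor act E₁ hE₁).X ⟶ X)
    (h₁₂ : serreTranslate act E₁ hE₁ P₁ ≫ χ₁ = serreTranslate act E₁ hE₁ P₁ ≫ χ₂) : χ₁ = χ₂ := by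
  haveI := isMonHom_serreTranslate act E₁ hE₁ P₁
  haveI := isFinite_serreTranslate_left act E₁ hE₁ P₁ Q₁ hN₁ hP₁ hQ₁ hQP₁ hPQ₁
  haveI := flat_serreTranslate_left act E₁ hE₁ P₁ Q₁ hN₁ hP₁ hQ₁ hQP₁ hPQ₁
  haveI := surjective_serreTranslate_left act E₁ hE₁ P₁ Q₁ hN₁ hP₁ hQ₁ hQP₁ hPQ₁
  exact cancel_left_of_flat_surjective A (C := serreTensor act E₁ hE₁) (serreTranslate act E₁ hE₁ P₁) h₁₂

end Compose

/-! ## §2 σ2-CORE, `π₀`-free form: `A^{(q)} ≅ B ⊗ 𝔞⁻¹` with `F ≫ e′ = ρ′ ≫ χ`, `ψ_𝔭 ≫ χ = ψ_𝔞` -/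

section Frobenius

open Literature.AlgebraicGeometry.Motives Literature.AlgebraicGeometry.Motives.AbelianVariety

variable {k : Type u} [Field k] (p : ℕ) [ExpChar k p] (n : ℕ) {A B : AbelianVariety k} {O : Type*} [CommRing O]
  (act : (AbelianScheme.ofAbelianVariety A).toOver.RingAction O) [IsMonHom (relFrobeniusHom p n A)]
  (actB : (AbelianScheme.ofAbelianVariety B).toOver.RingAction O) [IsCommMonObj (AbelianScheme.ofAbelianVariety B).toOver.X]
  {m₁ : ℕ} (E₁ : Matrix (Fin m₁) (Fin m₁) O) (hE₁ : E₁ * E₁ = E₁) (P₁ : Matrix (Fin m₁) (Fin 1) O) (Q₁ : Matrix (Fin 1) (Fin m₁) O) {N₁ : ℕ}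
  {m₂ : ℕ} (E₂ : Matrix (Fin m₂) (Fin m₂) O) (hE₂ : E₂ * E₂ = E₂) (P₂ : Matrix (Fin m₂) (Fin 1) O) (Q₂ : Matrix (Fin 1) (Fin m₂) O) {N₂ : ℕ}
  {m₃ : ℕ} (E₃ : Matrix (Fin m₃) (Fin m₃) O) (hE₃ : E₃ * E₃ = E₃) (P₃ : Matrix (Fin m₃) (Fin 1) O) (Q₃ : Matrix (Fin 1) (Fin m₃) O) {N₃ : ℕ}
  [IsCommMonObj (serreTensor actB E₁ hE₁).X]
  (ρ' : (AbelianScheme.ofAbelianVariety A).toOver.X ⟶ (serreTensor actB E₁ hE₁).X) [IsMonHom ρ'] [Flat ρ'.left] [Surjective ρ'.left]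
  [QuasiCompact ρ'.left]

include hE₂ in
/-- **(σ2-CORE, `π₀`-FREE) `A^{(q)} ≅ B ⊗ 𝔞⁻¹`.**  Data as in ★ σ2-CORE §4 but WITHOUT a generator of `𝔞 = 𝔭𝔠`: the Hecke datum `ρ′ : A → B ⊗ 𝔭⁻¹`
(`𝒪`-equivariant fppf), the block computation `Ker F = ρ′⁻¹((B ⊗ 𝔭⁻¹)[𝔠])`, and presentations of `𝔭⁻¹`, `𝔠⁻¹`, `𝔞⁻¹` with `𝔭𝔠 = 𝔞`.  CONCLUSION: an
`𝒪`-equivariant isomorphism of abelian `k`-schemes `e′ : A^{(q)} ≅ B ⊗ 𝔞⁻¹` (a homomorphism) and the cover `χ : B ⊗ 𝔭⁻¹ → B ⊗ 𝔞⁻¹` (`ψ_𝔭 ≫ χ = ψ_𝔞`, §1)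
with **`F ≫ e′ = ρ′ ≫ χ`** — the Frobenius twist IS the Hecke quotient Serre-twisted by the IDEAL `𝔞` (= `twistIdeal γ_σ` of the desk՚s (TW)), the form in
which EXACT full level structures match (`F ∘ lvl ↦ χ ∘ ρ′ ∘ lvl`, no unit `π₀ mod N`; NOTE «π₀ and exact level»). [cite: Shimura1998, §13.1 Thm. 1 (pp. 97–99)]
[cite: MilneCM2006, §7 (Def. 7.19, Prop. 7.22, Rem. 7.23)] [cite: RapoportSmithlingZhang2020Diagonal, §4.3 (p. 20)] [cite: MumfordAV1970, §7 Thm. 4 (p. 72)] -/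
theorem exists_iso_relFrobeniusHom_comp_eq_comp_serreTranslate_of_mul_eq (hρ' : ∀ a, act.i a ≫ ρ' = ρ' ≫ (serreAction actB E₁ hE₁).i a)
    (hN₁ : N₁ ≠ 0) (hP₁ : E₁ * P₁ = P₁) (hQ₁ : Q₁ * E₁ = Q₁)
    (hQP₁ : Q₁ * P₁ = Matrix.scalar (Fin 1) (N₁ : O)) (hPQ₁ : P₁ * Q₁ = Matrix.scalar (Fin m₁) (N₁ : O) * E₁)
    (hN₂ : N₂ ≠ 0) (hP₂ : E₂ * P₂ = P₂) (hQ₂ : Q₂ * E₂ = Q₂)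
    (hQP₂ : Q₂ * P₂ = Matrix.scalar (Fin 1) (N₂ : O)) (hPQ₂ : P₂ * Q₂ = Matrix.scalar (Fin m₂) (N₂ : O) * E₂)
    (hN₃ : N₃ ≠ 0) (hP₃ : E₃ * P₃ = P₃) (hQ₃ : Q₃ * E₃ = Q₃)
    (hQP₃ : Q₃ * P₃ = Matrix.scalar (Fin 1) (N₃ : O)) (hPQ₃ : P₃ * Q₃ = Matrix.scalar (Fin m₃) (N₃ : O) * E₃)
    {𝔭 𝔠 𝔞 : Ideal O} (h𝔭 : Ideal.span (Set.range fun k => P₁ k 0) = 𝔭) (h𝔠 : Ideal.span (Set.range fun k => P₂ k 0) = 𝔠)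
    (h𝔞 : Ideal.span (Set.range fun k => P₃ k 0) = 𝔞) (hmul : 𝔭 * 𝔠 = 𝔞)
    (hker : ∀ ⦃T : Over (Spec (.of k))⦄ (t : T ⟶ (AbelianScheme.ofAbelianVariety A).toOver.X),
      t ≫ relFrobeniusHom p n A = 1 ↔ ∀ c ∈ 𝔠, t ≫ act.i c ≫ ρ' = 1) :
    ∃ e' : (AbelianScheme.ofAbelianVariety (A.frobeniusTwist p n)).toOver.X ≅ (serreTensor actB E₃ hE₃).X,
      IsMonHom e'.hom ∧ (∀ a, (act.frobeniusTwist p n).i a ≫ e'.hom = e'.hom ≫ (serreAction actB E₃ hE₃).i a) ∧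
        ∃ χ : (serreTensor actB E₁ hE₁).X ⟶ (serreTensor actB E₃ hE₃).X, IsMonHom χ ∧
          (∀ a, (serreAction actB E₁ hE₁).i a ≫ χ = χ ≫ (serreAction actB E₃ hE₃).i a) ∧
            serreTranslate actB E₁ hE₁ P₁ ≫ χ = serreTranslate actB E₃ hE₃ P₃ ∧ relFrobeniusHom p n A ≫ e'.hom = ρ' ≫ χ := by
  obtain ⟨e₁, he₁, he₁mon, he₁eq, -⟩ := exists_iso_relFrobeniusHom_comp_eq_comp_serreTranslate p n act
    (serreAction actB E₁ hE₁) ρ' E₂ hE₂ P₂ Q₂ hρ' hN₂ hP₂ hQ₂ hQP₂ hPQ₂ h𝔠 hker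
  obtain ⟨e, he, hemon, heeq, -⟩ := exists_iso_serreTranslate_comp_serreTranslate_comp_eq_serreTranslate actB E₁ hE₁ P₁ Q₁ E₂ hE₂ P₂ Q₂
    E₃ hE₃ P₃ Q₃ hN₁ hP₁ hQ₁ hQP₁ hPQ₁ hN₂ hP₂ hQ₂ hQP₂ hPQ₂ hN₃ hP₃ hQ₃ hQP₃ hPQ₃ h𝔭 h𝔠 h𝔞 hmul
  haveI := he₁mon
  haveI := hemon
  haveI := isMonHom_serreTranslate (serreAction actB E₁ hE₁) E₂ hE₂ P₂
  refine ⟨e₁ ≪≫ e, ?_, fun a => ?_, serreTranslate (serreAction actB E₁ hE₁) E₂ hE₂ P₂ ≫ e.hom, ?_, fun a => ?_, he, ?_⟩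
  · rw [Iso.trans_hom]; infer_instance
  · rw [Iso.trans_hom, ← Category.assoc, he₁eq a, Category.assoc, heeq a, Category.assoc]
  · infer_instance
  · rw [← Category.assoc, i_comp_serreTranslate (serreAction actB E₁ hE₁) E₂ hE₂ P₂ hP₂ a, Category.assoc, heeq a, Category.assoc]
  · rw [Iso.trans_hom, ← Category.assoc, he₁, Category.assoc]

end Frobenius

end AbelianSchemeOver

end Literature.AlgebraicGeometry.AbelianSchemes

end
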